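import Summits.QuantumFields.GaugeBoot.TwistedSlabHaar
import Summits.QuantumFields.GaugeBoot.FlowSchwingerDyson
import Mathlib.MeasureTheory.Integral.Bochner.Set
import Mathlib.MeasureTheory.Integral.Prod
import HarnessLib

/-!
# Averaging over a compact symmetry group: orbit averages of observables and of states (gauge-boot, L1 supplement)

HONEST FRAMING (cell `pub-gaugeboot`, page 1 of every file): the venture produces certified bounds
on lattice expectations at stated coupling, gauge group, dimension and torus size; NOT a mass gap,
NOT a continuum limit, NOT a string tension; NOT Yang–Mills-summit-bearing (barriers
`FixedCouplingUltralocality`, `PerturbativeInvisibility`). This module is measure-theoretic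
bookkeeping; it certifies no number.

## Content

A compact group `H` (in the sequels: the lattice GAUGE GROUP `sites → G`, compact as a product)
acts on a configuration space `Ω` by `act : H → Ω → Ω` (`act (h h') = act h ∘ act h'`, jointly
continuous). With `dh` the normalised Haar measure of `H`:

* `orbitAverage act F x = ∫ F (act h x) dh` — the `H`-average of an observable: `act`-invariant
  (`orbitAverage_act`, right invariance of Haar measure), equal to `F` when `F` is invariant,
  continuous when `F` is (`continuous_orbitAverage`), commuting with every map that commutes with
  the action (`orbitAverage_comp_comm`), and with the same integral as `F` against every
  `act`-invariant finite measure (`integral_orbitAverage_eq_of_map_eq`, Fubini);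
* `avgMeasure act μ = (dh ⊗ μ) ∘ act⁻¹` — the `H`-average of a state: a probability measure when
  `μ` is, `act`-invariant (`map_avgMeasure_act`, left invariance of Haar measure), with
  `∫ F d(avgMeasure μ) = ∫ orbitAverage F dμ` (`integral_avgMeasure`), hence agreeing with `μ` on
  every invariant observable (`integral_avgMeasure_of_invariant`) and every invariant event
  (`avgMeasure_apply_of_invariant`).

These are the two averaging operations behind `InvariantSchwingerDysonRows.lean`: loop-equation rows
along CENTRAL one-parameter subgroups see only gauge-invariant data, and for them the
gauge-invariant test functions are as good as all test functions.

References: H.-O. Georgii, *Gibbs Measures and Phase Transitions* (2011) §5.1 (symmetries);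
E. Seiler, LNP 159 (1982) Ch. 2. Folklore.
-/

noncomputable section

open MeasureTheory
open Literature.MathematicalPhysics.QuantumFieldTheory (haarProbability)

namespace Summit.QuantumFields.GaugeBoot

variable {H : Type*} [Group H] [TopologicalSpace H] [IsTopologicalGroup H] [CompactSpace H]
  [MeasurableSpace H] [BorelSpace H]
variable {Ω : Type*} [TopologicalSpace Ω] [MeasurableSpace Ω]

/-- **Orbit average of an observable** over the compact group `H` acting by `act`:
`orbitAverage act F x = ∫ F (act h x) dh`, `dh` the normalised Haar measure. [folklore] -/
def orbitAverage (act : H → Ω → Ω) (F : Ω → ℝ) (x : Ω) : ℝ :=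
  ∫ h, F (act h x) ∂haarProbability H

/-- **Average of a state** over the compact group `H` acting by `act`: the push-forward of
`dh ⊗ μ` under `(h, x) ↦ act h x`, i.e. `(avgMeasure act μ)(A) = ∫ μ((act h)⁻¹ A) dh`. [folklore] -/
def avgMeasure (act : H → Ω → Ω) (μ : Measure Ω) : Measure Ω :=
  ((haarProbability H).prod μ).map fun p : H × Ω => act p.1 p.2

variable {act : H → Ω → Ω}

/-! ## Orbit averages of observables -/

section Observables

omit [TopologicalSpace Ω] [MeasurableSpace Ω] in
/-- The orbit average of an `act`-invariant observable is the observable itself. [folklore] -/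
theorem orbitAverage_of_invariant {F : Ω → ℝ} (hF : ∀ h x, F (act h x) = F x) :
    orbitAverage act F = F := by
  funext x
  simp [orbitAverage, hF]

omit [TopologicalSpace Ω] [MeasurableSpace Ω] in
/-- **Orbit averages are invariant**: `orbitAverage F (act h' x) = orbitAverage F x` (right
invariance of the Haar measure of the compact group `H`). [folklore] -/
theorem orbitAverage_act (hmul : ∀ h h' x, act (h * h') x = act h (act h' x)) (F : Ω → ℝ)
    (h' : H) (x : Ω) : orbitAverage act F (act h' x) = orbitAverage act F x := by
  simp only [orbitAverage, ← hmul]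
  exact integral_mul_right_eq_self (μ := haarProbability H) (fun h => F (act h x)) h'

omit [TopologicalSpace Ω] [MeasurableSpace Ω] in
/-- Pre-composition with a fixed group element does not change the orbit average (left invariance
of Haar measure): `orbitAverage (F ∘ act h') = orbitAverage F`. [folklore] -/
theorem orbitAverage_comp_act (hmul : ∀ h h' x, act (h * h') x = act h (act h' x)) (F : Ω → ℝ)
    (h' : H) : orbitAverage act (fun x => F (act h' x)) = orbitAverage act F := by
  funext x
  simp only [orbitAverage, ← hmul]
  exact integral_mul_left_eq_self (μ := haarProbability H) (fun h => F (act h x)) h'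

omit [TopologicalSpace Ω] [MeasurableSpace Ω] in
/-- An invariant factor comes out of the orbit average:
`orbitAverage (F · w) = orbitAverage F · w` for `act`-invariant `w`. [folklore] -/
theorem orbitAverage_mul_of_invariant (F : Ω → ℝ) {w : Ω → ℝ} (hw : ∀ h x, w (act h x) = w x) :
    orbitAverage act (fun x => F x * w x) = fun x => orbitAverage act F x * w x := by
  funext x
  simp only [orbitAverage, hw]
  exact integral_mul_const (w x) _

omit [TopologicalSpace Ω] [MeasurableSpace Ω] in
/-- **Orbit averaging commutes with every map commuting with the action**:
`orbitAverage (F ∘ T) = (orbitAverage F) ∘ T` when `act h ∘ T = T ∘ act h` for all `h` (in the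
sequel: `T` = a one-link shift along a CENTRAL one-parameter subgroup). [folklore] -/
theorem orbitAverage_comp_comm (F : Ω → ℝ) {T : Ω → Ω} (hT : ∀ h x, act h (T x) = T (act h x)) :
    orbitAverage act (fun x => F (T x)) = fun x => orbitAverage act F (T x) := by
  funext x
  simp only [orbitAverage, hT]

omit [MeasurableSpace Ω] in
/-- **Orbit averages of continuous observables are continuous** (jointly continuous action;
parametric integral over the compact group). [folklore] -/
theorem continuous_orbitAverage [FirstCountableTopology Ω] [LocallyCompactSpace Ω]
    (hact : Continuous fun p : H × Ω => act p.1 p.2) {F : Ω → ℝ} (hF : Continuous F) :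
    Continuous (orbitAverage act F) := by
  have h := continuous_parametric_integral_of_continuous (μ := haarProbability H)
    (f := fun (x : Ω) (h : H) => F (act h x))
    (hF.comp (hact.comp (continuous_snd.prodMk continuous_fst))) isCompact_univ
  rw [Measure.restrict_univ] at h
  exact h

variable [OpensMeasurableSpace Ω] [CompactSpace Ω] [SecondCountableTopology H]

/-- Joint integrability of `(h, x) ↦ F (act h x)` for a continuous observable on the compact
space against `dh ⊗ μ`, `μ` finite. [folklore] -/
theorem integrable_comp_act_prod (hact : Continuous fun p : H × Ω => act p.1 p.2) {F : Ω → ℝ}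
    (hF : Continuous F) (μ : Measure Ω) [IsFiniteMeasure μ] :
    Integrable (fun p : H × Ω => F (act p.1 p.2)) ((haarProbability H).prod μ) :=
  IsContinuousFlow.integrable_of_continuous_of_compactSpace _ (hF.comp hact)

/-- **Fubini for orbit averages**: `∫ orbitAverage F dμ = ∫ (∫ F (act h x) dμ) dh`. [folklore] -/
theorem integral_orbitAverage (hact : Continuous fun p : H × Ω => act p.1 p.2) {F : Ω → ℝ}
    (hF : Continuous F) (μ : Measure Ω) [IsFiniteMeasure μ] :
    ∫ x, orbitAverage act F x ∂μ = ∫ h, ∫ x, F (act h x) ∂μ ∂haarProbability H := by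
  have hi : Integrable (Function.uncurry fun (x : Ω) (h : H) => F (act h x))
      (μ.prod (haarProbability H)) :=
    IsContinuousFlow.integrable_of_continuous_of_compactSpace _
      (hF.comp (hact.comp (continuous_snd.prodMk continuous_fst)))
  exact integral_integral_swap hi

variable [BorelSpace Ω]

/-- **An `act`-invariant state integrates the orbit average of a continuous observable to the
integral of the observable**: `∫ orbitAverage F dμ = ∫ F dμ` when `μ ∘ (act h)⁻¹ = μ` for all `h`.
[folklore] -/
theorem integral_orbitAverage_eq_of_map_eq (hact : Continuous fun p : H × Ω => act p.1 p.2)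
    {F : Ω → ℝ} (hF : Continuous F) (μ : Measure Ω) [IsFiniteMeasure μ]
    (hμ : ∀ h, μ.map (act h) = μ) : ∫ x, orbitAverage act F x ∂μ = ∫ x, F x ∂μ := by
  rw [integral_orbitAverage hact hF μ]
  have hh : ∀ h, ∫ x, F (act h x) ∂μ = ∫ x, F x ∂μ := fun h => by
    have hm : Measurable (act h) := (hact.comp (continuous_const.prodMk continuous_id)).measurable
    rw [← integral_map hm.aemeasurable hF.aestronglyMeasurable, hμ h]
  simp [hh]

end Observables

/-! ## Averages of states -/

section States

variable [BorelSpace Ω] [SecondCountableTopology H]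

omit [TopologicalSpace Ω] [BorelSpace Ω] [SecondCountableTopology H] in
/-- The average of a finite measure is finite. [folklore] -/
theorem isFiniteMeasure_avgMeasure (μ : Measure Ω) [IsFiniteMeasure μ] :
    IsFiniteMeasure (avgMeasure act μ) := by
  unfold avgMeasure
  infer_instance

omit [Group H] [IsTopologicalGroup H] [CompactSpace H] in
/-- The averaging map `(h, x) ↦ act h x` is measurable (jointly continuous action). [folklore] -/
theorem measurable_act_uncurry (hact : Continuous fun p : H × Ω => act p.1 p.2) :
    Measurable fun p : H × Ω => act p.1 p.2 :=
  hact.measurable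

/-- The average of a probability measure is a probability measure. [folklore] -/
theorem isProbabilityMeasure_avgMeasure (hact : Continuous fun p : H × Ω => act p.1 p.2)
    (μ : Measure Ω) [IsProbabilityMeasure μ] : IsProbabilityMeasure (avgMeasure act μ) :=
  Measure.isProbabilityMeasure_map (measurable_act_uncurry hact).aemeasurable

/-- **Integrals against the averaged state are integrals of orbit averages**:
`∫ F d(avgMeasure μ) = ∫ orbitAverage F dμ` for continuous `F` on the compact space. [folklore] -/
theorem integral_avgMeasure [CompactSpace Ω] (hact : Continuous fun p : H × Ω => act p.1 p.2)
    {F : Ω → ℝ} (hF : Continuous F) (μ : Measure Ω) [IsFiniteMeasure μ] :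
    ∫ x, F x ∂avgMeasure act μ = ∫ x, orbitAverage act F x ∂μ := by
  unfold avgMeasure orbitAverage
  rw [integral_map (measurable_act_uncurry hact).aemeasurable hF.aestronglyMeasurable]
  exact integral_prod_symm _ (integrable_comp_act_prod hact hF μ)

/-- **The averaged state agrees with the state on invariant observables**:
`∫ F d(avgMeasure μ) = ∫ F dμ` for continuous `act`-invariant `F`. [folklore] -/
theorem integral_avgMeasure_of_invariant [CompactSpace Ω]
    (hact : Continuous fun p : H × Ω => act p.1 p.2) {F : Ω → ℝ} (hF : Continuous F)
    (hFi : ∀ h x, F (act h x) = F x) (μ : Measure Ω) [IsFiniteMeasure μ] :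
    ∫ x, F x ∂avgMeasure act μ = ∫ x, F x ∂μ := by
  rw [integral_avgMeasure hact hF μ, orbitAverage_of_invariant hFi]

omit [TopologicalSpace Ω] [BorelSpace Ω] [SecondCountableTopology H] in
/-- **The averaged state agrees with the state on invariant events**: for a measurable set `A`
with `(act h)⁻¹ A = A` for all `h`, `(avgMeasure μ)(A) = μ(A)`. [folklore] -/
theorem avgMeasure_apply_of_invariant (hact : Measurable fun p : H × Ω => act p.1 p.2)
    (μ : Measure Ω) [SFinite μ] {A : Set Ω} (hA : MeasurableSet A)
    (hAi : ∀ h x, act h x ∈ A ↔ x ∈ A) : avgMeasure act μ A = μ A := by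
  unfold avgMeasure
  rw [Measure.map_apply hact hA]
  have hpre : (fun p : H × Ω => act p.1 p.2) ⁻¹' A = Set.univ ×ˢ A := by
    ext p
    simp [hAi]
  rw [hpre, Measure.prod_prod, measure_univ, one_mul]

/-- **The averaged state is invariant**: `(avgMeasure μ) ∘ (act h')⁻¹ = avgMeasure μ` (left
invariance of the Haar measure of `H`; tested on bounded continuous functions). [folklore] -/
theorem map_avgMeasure_act [CompactSpace Ω] [HasOuterApproxClosed Ω]
    (hmul : ∀ h h' x, act (h * h') x = act h (act h' x))
    (hact : Continuous fun p : H × Ω => act p.1 p.2) (μ : Measure Ω) [IsFiniteMeasure μ]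
    (h' : H) : (avgMeasure act μ).map (act h') = avgMeasure act μ := by
  haveI := isFiniteMeasure_avgMeasure (act := act) μ
  have hm : Measurable (act h') := (hact.comp (continuous_const.prodMk continuous_id)).measurable
  haveI : IsFiniteMeasure ((avgMeasure act μ).map (act h')) := Measure.isFiniteMeasure_map _ _
  refine ext_of_forall_integral_eq_of_IsFiniteMeasure fun f => ?_
  have hfc : Continuous fun x => f (act h' x) :=
    f.continuous.comp (hact.comp (continuous_const.prodMk continuous_id))
  rw [integral_map hm.aemeasurable f.continuous.aestronglyMeasurable,
    integral_avgMeasure hact hfc μ, orbitAverage_comp_act hmul (fun x => f x) h',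
    integral_avgMeasure hact f.continuous μ]

/-- The average of an invariant state is the state itself (tested on bounded continuous
functions). [folklore] -/
theorem avgMeasure_eq_self_of_map_eq [CompactSpace Ω] [HasOuterApproxClosed Ω]
    (hact : Continuous fun p : H × Ω => act p.1 p.2) (μ : Measure Ω) [IsFiniteMeasure μ]
    (hμ : ∀ h, μ.map (act h) = μ) : avgMeasure act μ = μ := by
  haveI := isFiniteMeasure_avgMeasure (act := act) μ
  refine ext_of_forall_integral_eq_of_IsFiniteMeasure fun f => ?_
  rw [integral_avgMeasure hact f.continuous μ, integral_orbitAverage_eq_of_map_eq hact f.continuous μ hμ]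

end States

end Summit.QuantumFields.GaugeBoot

end
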